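import Mathlib.Data.ZMod.Defs
import Mathlib.Data.Fintype.Basic
import Mathlib.Algebra.Group.Pi.Lemmas
import Mathlib.Data.Nat.Prime.Defs
import Mathlib.Order.Fin.Basic
import Mathlib.Data.Finset.Max
import HarnessLib

/-!
# Weight combinatorics of the de Rham complex of a ring with a `p`-basis

Pure combinatorics used by the monomial decomposition of the de Rham complex `(⋀ⁿ Ω_R, d)` of a ring `R`
with a finite `p`-basis `t : ι → R` (files `PBasis*`, `CartierIsomorphism`).  The twisted basis vectors of
`Ωⁿ_R` are indexed by pairs `(α, s)` — an exponent vector `α : ι → Fin p` and a set `s : Finset ι` of `n`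
indices — standing for `t^α • dt_s`.  The exterior derivative preserves the **weight**

  `wt α s i = α i + [i ∈ s] ∈ {0, …, p}`,

and on the part of weight `w` it is the Koszul complex of the family of units `(w_i)_{i ∈ live}`,
`live α s = {i | 0 < wt α s i < p}`: acyclic as soon as `live ≠ ∅` (contracting homotopy: divide by
`w_{i₀}`, `i₀ = min live`, and remove `dt_{i₀}`), while `live = ∅` singles out the Cartier vectors
`t_s^{p-1} dt_s`.  This file records the bookkeeping: the weight is unchanged by the "d-move"
`(α, s) ↦ (α - e_i, insert i s)` (`i ∉ s`, `α i ≠ 0`) and by the "h-move" `(α, s) ↦ (α + e_i, s.erase i)`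
(`i ∈ s`, `α i + 1 < p`), membership criteria for `live`, and the description of `live = ∅`.

## References

* L. Illusie, *Complexe de de Rham–Witt et cohomologie cristalline*, Ann. Sci. ÉNS 12 (1979), 0.(2.2.3)
  (the grading of the de Rham complex of a polynomial algebra used in Cartier's theorem). [Illusie1979]
* N. Katz, *Nilpotent connections and the monodromy theorem*, Publ. IHÉS 39 (1970), Thm. 7.2. [folklore]
-/

namespace Literature.NumberTheory.GaloisCohomology

namespace DeRhamWeights

universe v

variable {ι : Type v} [DecidableEq ι] {p : ℕ}

/-! ### Weights -/

/-- The **weight** of the basis vector `t^α • dt_s` at the index `i`: `α i + [i ∈ s]`. [cite: Illusie1979, 0.(2.2.3)] -/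
def wt (α : ι → Fin p) (s : Finset ι) (i : ι) : ℕ :=
  (α i : ℕ) + if i ∈ s then 1 else 0

/-- Weight at an index in `s`. [folklore] -/
theorem wt_of_mem {α : ι → Fin p} {s : Finset ι} {i : ι} (hi : i ∈ s) : wt α s i = (α i : ℕ) + 1 := by
  rw [wt, if_pos hi]

/-- Weight at an index outside `s`. [folklore] -/
theorem wt_of_not_mem {α : ι → Fin p} {s : Finset ι} {i : ι} (hi : i ∉ s) : wt α s i = (α i : ℕ) := by
  rw [wt, if_neg hi, Nat.add_zero]

/-- Weights are at most `p`. [folklore] -/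
theorem wt_le (α : ι → Fin p) (s : Finset ι) (i : ι) : wt α s i ≤ p := by
  have := (α i).2
  unfold wt
  split_ifs <;> omega

/-- The value of `α - e_i` at `i` when `α i ≠ 0`: no wrap-around. [folklore] -/
theorem val_sub_single_self [NeZero p] {α : ι → Fin p} {i : ι} (hα : α i ≠ 0) :
    ((α - Pi.single i 1 : ι → Fin p) i : ℕ) = (α i : ℕ) - 1 := by
  rw [Pi.sub_apply, Pi.single_eq_same]
  exact Fin.val_sub_one_of_ne_zero hα

/-- The value of `α - e_i` away from `i`. [folklore] -/
theorem sub_single_apply_of_ne [NeZero p] (α : ι → Fin p) {i j : ι} (h : j ≠ i) :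
    (α - Pi.single i 1 : ι → Fin p) j = α j := by
  rw [Pi.sub_apply, Pi.single_eq_of_ne h, sub_zero]

/-- The value of `α + e_i` at `i` when `α i + 1 < p`: no wrap-around. [folklore] -/
theorem val_add_single_self [NeZero p] {α : ι → Fin p} {i : ι} (hα : (α i : ℕ) + 1 < p) :
    ((α + Pi.single i 1 : ι → Fin p) i : ℕ) = (α i : ℕ) + 1 := by
  rw [Pi.add_apply, Pi.single_eq_same]
  exact Fin.val_add_one_of_lt' hα

/-- The value of `α + e_i` away from `i`. [folklore] -/
theorem add_single_apply_of_ne [NeZero p] (α : ι → Fin p) {i j : ι} (h : j ≠ i) :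
    (α + Pi.single i 1 : ι → Fin p) j = α j := by
  rw [Pi.add_apply, Pi.single_eq_of_ne h, add_zero]

/-- **The d-move preserves weights**: `wt (α - e_i) (insert i s) = wt α s` for `i ∉ s`, `α i ≠ 0`.
[cite: Illusie1979, 0.(2.2.3)] -/
theorem wt_dMove [NeZero p] {α : ι → Fin p} {s : Finset ι} {i : ι} (hi : i ∉ s) (hα : α i ≠ 0) :
    wt (α - Pi.single i 1) (insert i s) = wt α s := by
  funext j
  by_cases hj : j = i
  · subst hj
    rw [wt_of_mem (Finset.mem_insert_self j s), wt_of_not_mem hi, val_sub_single_self hα]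
    have : (α j : ℕ) ≠ 0 := fun h => hα (Fin.ext (by rw [h]; rfl))
    omega
  · unfold wt
    rw [sub_single_apply_of_ne α hj]
    simp only [Finset.mem_insert, hj, false_or]

/-- **The h-move preserves weights**: `wt (α + e_i) (s.erase i) = wt α s` for `i ∈ s`, `α i + 1 < p`.
[cite: Illusie1979, 0.(2.2.3)] -/
theorem wt_hMove [NeZero p] {α : ι → Fin p} {s : Finset ι} {i : ι} (hi : i ∈ s)
    (hα : (α i : ℕ) + 1 < p) : wt (α + Pi.single i 1) (s.erase i) = wt α s := by
  funext j
  by_cases hj : j = i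
  · subst hj
    rw [wt_of_not_mem (Finset.notMem_erase j s), wt_of_mem hi, val_add_single_self hα]
  · unfold wt
    rw [add_single_apply_of_ne α hj]
    simp only [Finset.mem_erase, ne_eq, hj, not_false_eq_true, true_and]

/-! ### Live indices -/

variable [Fintype ι]

/-- The **live indices** of `(α, s)`: those where the weight is neither `0` nor `p`.  On the weight class of
`(α, s)` the de Rham differential is the Koszul complex of the units `(wt α s i)_{i ∈ live}`.
[cite: Illusie1979, 0.(2.2.3)] -/
def live (α : ι → Fin p) (s : Finset ι) : Finset ι :=
  Finset.univ.filter fun i => 0 < wt α s i ∧ wt α s i < p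

/-- Membership in `live`. [folklore] -/
theorem mem_live_iff {α : ι → Fin p} {s : Finset ι} {i : ι} :
    i ∈ live α s ↔ 0 < wt α s i ∧ wt α s i < p := by
  simp [live]

/-- `live` depends only on the weight function. [folklore] -/
theorem live_congr {α β : ι → Fin p} {s s' : Finset ι} (h : wt α s = wt β s') : live α s = live β s' := by
  unfold live
  rw [h]

/-- A live index inside `s` has `α i + 1 < p`. [folklore] -/
theorem mem_live_iff_of_mem {α : ι → Fin p} {s : Finset ι} {i : ι} (hi : i ∈ s) :
    i ∈ live α s ↔ (α i : ℕ) + 1 < p := by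
  rw [mem_live_iff, wt_of_mem hi]
  omega

/-- A live index outside `s` has `α i ≠ 0`. [folklore] -/
theorem mem_live_iff_of_not_mem [NeZero p] {α : ι → Fin p} {s : Finset ι} {i : ι} (hi : i ∉ s) :
    i ∈ live α s ↔ α i ≠ 0 := by
  rw [mem_live_iff, wt_of_not_mem hi]
  have := (α i).2
  constructor
  · rintro ⟨h0, -⟩ h
    rw [h, Fin.val_zero] at h0
    exact Nat.lt_irrefl _ h0
  · intro h
    refine ⟨Nat.pos_of_ne_zero fun h' => h (Fin.ext (by rw [h', Fin.val_zero])), this⟩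

/-- The d-move preserves `live`. [folklore] -/
theorem live_dMove [NeZero p] {α : ι → Fin p} {s : Finset ι} {i : ι} (hi : i ∉ s) (hα : α i ≠ 0) :
    live (α - Pi.single i 1) (insert i s) = live α s :=
  live_congr (wt_dMove hi hα)

/-- The h-move preserves `live`. [folklore] -/
theorem live_hMove [NeZero p] {α : ι → Fin p} {s : Finset ι} {i : ι} (hi : i ∈ s)
    (hα : (α i : ℕ) + 1 < p) : live (α + Pi.single i 1) (s.erase i) = live α s :=
  live_congr (wt_hMove hi hα)

/-- **No live index**: outside `s` the exponent vanishes (so `d` kills `t^α • dt_s`). [folklore] -/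
theorem apply_eq_zero_of_live_eq_empty [NeZero p] {α : ι → Fin p} {s : Finset ι} (h : live α s = ∅) {i : ι}
    (hi : i ∉ s) : α i = 0 := by
  by_contra hne
  have : i ∈ live α s := (mem_live_iff_of_not_mem hi).2 hne
  rw [h] at this
  exact Finset.notMem_empty i this

/-- **No live index**: inside `s` the exponent is `p - 1` (the Cartier vectors `t_s^{p-1} dt_s`). [folklore] -/
theorem val_apply_eq_of_live_eq_empty {α : ι → Fin p} {s : Finset ι} (h : live α s = ∅) {i : ι}
    (hi : i ∈ s) : (α i : ℕ) = p - 1 := by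
  have h1 := (α i).2
  by_contra hne
  have : i ∈ live α s := (mem_live_iff_of_mem hi).2 (by omega)
  rw [h] at this
  exact Finset.notMem_empty i this

/-- Characterisation of `live α s = ∅`. [folklore] -/
theorem live_eq_empty_iff [NeZero p] {α : ι → Fin p} {s : Finset ι} :
    live α s = ∅ ↔ ∀ i, (i ∈ s → (α i : ℕ) = p - 1) ∧ (i ∉ s → α i = 0) := by
  constructor
  · intro h i
    exact ⟨val_apply_eq_of_live_eq_empty h, apply_eq_zero_of_live_eq_empty h⟩
  · intro h
    ext i
    simp only [Finset.notMem_empty, iff_false]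
    intro hl
    by_cases hi : i ∈ s
    · have := (mem_live_iff_of_mem hi).1 hl
      have := (h i).1 hi
      omega
    · exact (mem_live_iff_of_not_mem hi).1 hl ((h i).2 hi)

/-- The minimum live index lies in `live`. [folklore] -/
theorem min'_mem_live [LinearOrder ι] {α : ι → Fin p} {s : Finset ι} (h : (live α s).Nonempty) :
    (live α s).min' h ∈ live α s :=
  Finset.min'_mem _ h

end DeRhamWeights

end Literature.NumberTheory.GaloisCohomology
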